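import Mathlib
import Summits.CriticalPhenomena.CardyFormulaZ2.Theorems.CardyMagicRigidityNestingRigidityBondTranslation
import Summits.CriticalPhenomena.CardyFormulaZ2.Theorems.CardyMagicRigidityNestingRigidityUVExpMomentsDilation
import Literature.Probability.Percolation.SiteLoopDensity
import Literature.Probability.Percolation.SitePercolationMeasure
import Literature.Probability.Percolation.LoopRotationInvarianceProofs
import Literature.Probability.Percolation.LoopTraversalBound
import HarnessLib

/-!
# Crux `NestingRigidity`, line `positive-cone-weight-doubling`: lattice translations act on the
# typed loop representation of site-`𝕋` by translating the loops, and preserve `P_{1/2}`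

Crux `Summit.CriticalPhenomena.CardyFormulaZ2.Theses.CardyMagicRigidity.NestingRigidity`
(stmt-CriticalPhenomena-4835), line `positive-cone-weight-doubling`, registered helper Ξ₂
`uvFarBiteSq_expMoment_latticeEnsembles` (via keystone K6 at all centres,
`expMoment_ncard_bigLoops_le_ball`).  The site-`𝕋` twin of `…BondTranslation`
(`bondLoopConfig_relabel_shift`, bond-`ℤ²`): everything is configuration-by-configuration and
exact, no cited fact, no definition.

* §1 the two faces of a translated dart of `𝕋` are the translated faces (`triEdgeFaces_shift`,
  from `triFace_add`); `x + w ∈ ω + w ↔ x ∈ ω` for `ω + w = SiteConfig.relabel (Site.shift w) ω`;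
* §2 INTERFACE LOOPS transport along the honeycomb translation `hexAddHom w`
  (`isSiteInterfaceLoop_map_shift`);
* §3 the drawn polygon of the translated walk is the translated polygon (`hexLoopCurve_map_shift`,
  `siteLoopCurve_map_shift`), the shoelace type is unchanged (`shoelace_support_map_shift`);
* §4 EQUIVARIANCE (registered anchor `siteLoopConfig_relabel_shift`):
  `siteLoopConfig δ (ω + w) = (siteLoopConfig δ ω) + δ·triEmbed w` as TYPED configurations
  (`LoopConfig.map` along `z ↦ z + triMeshPoint δ w`), hence for the loop sets of `tEns`;
* §5 `ω ↦ ω + w` preserves `tEns.P = P_{1/2}` (`sitePercolation_map_relabel`), so **the law of the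
  loop set of `tEns` is invariant under `u ↦ u + δ w`, `w ∈ 𝕋`**
  (`integral_comp_translate_loops_tEns`), and, for BOTH lattice ensembles, every point `x` of the
  plane is within `2δ` of a vector `b` such that the loop set translated by `b` has the same law
  (`exists_near_translate_loops_latticeEnsembles`).
-/

noncomputable section

open MeasureTheory Set Filter Metric
open scoped Real Topology BigOperators

namespace Summit.CriticalPhenomena.CardyFormulaZ2.Cruxes.NestingRigidity.PositiveConeWeightDoubling

open Literature.Probability.RandomPlanarGeometry Literature.Probability.Percolation
  Literature.Probability.LatticeModels
open Summit.CriticalPhenomena.CardyFormulaZ2.Cruxes.NestingRigidity.RingCloudTomography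
open Summit.CriticalPhenomena.CardyFormulaZ2.Cruxes.NestingRigidity.MarkovCascadeOneGeneration
  (continuous_translate isometry_translate range_map_translate)

namespace SiteTranslation

/-- The translation `z ↦ z + b` of the plane as a continuous map (local notation, not a
definition; the affine form `1 * z + b` of `CurveClass.wind_map_affine`). -/
local notation3 "T[" b "]" => (⟨fun z : ℂ ↦ 1 * z + (b : ℂ), continuous_translate b⟩ : C(ℂ, ℂ))

/-! ## §1 Translated darts and translated configurations -/

/-- **The two faces of the translated dart `x + w → y + w` of `𝕋` are the translated faces** of the
dart `x → y` (translation covariance of `triFace`). -/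
theorem triEdgeFaces_shift (w : Site 2) (e : triGraph.Dart) :
    triEdgeFaces ⟨(e.fst + w, e.snd + w), (triGraph_adj_shift_iff w e.fst e.snd).2 e.adj⟩ =
      (hexAddHom w (triEdgeFaces e).1, hexAddHom w (triEdgeFaces e).2) := by
  obtain ⟨⟨x, y⟩, hxy⟩ := e
  have key : ∀ c : Site 2, triFace (x + w) (y + w) (x + w + c) =
      (w + (triFace x y (x + c)).1, (triFace x y (x + c)).2) := fun c ↦ by
    rw [add_comm x w, add_comm y w, add_assoc, ← triFace_add]
  change (triFace (x + w) (y + w) (x + w + triRot60 (y + w - (x + w))),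
      triFace (x + w) (y + w) (x + w + triRotNeg60 (y + w - (x + w)))) =
    (hexAddHom w (triFace x y (x + triRot60 (y - x))), hexAddHom w (triFace x y (x + triRotNeg60 (y - x))))
  rw [add_sub_add_right_eq_sub, key, key]
  rfl

/-- `x + w ∈ ω + w ↔ x ∈ ω`. -/
theorem add_mem_relabel_shift_iff (w : Site 2) (ω : SiteConfig (Site 2)) (x : Site 2) :
    x + w ∈ SiteConfig.relabel (Site.shift w) ω ↔ x ∈ ω := by
  rw [show x + w = Site.shift w x from rfl, SiteConfig.mem_relabel_iff, Equiv.symm_apply_apply]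

/-- Translating by `w` and then by `−w` restores the configuration. -/
theorem siteRelabel_shift_neg_shift (w : Site 2) (ω : SiteConfig (Site 2)) :
    SiteConfig.relabel (Site.shift (-w)) (SiteConfig.relabel (Site.shift w) ω) = ω := by
  ext x
  have h := add_mem_relabel_shift_iff (-w) (SiteConfig.relabel (Site.shift w) ω) (x + w)
  rw [add_neg_cancel_right] at h
  rw [h, add_mem_relabel_shift_iff]

/-! ## §2 Transport of interface loops along honeycomb translations -/

/-- **The translate of a site interface loop is a site interface loop of the translated
configuration**: cycles map to cycles along the injective graph homomorphism `hexAddHom w`, and the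
dart of `𝕋` crossed by a step translates together with its two faces and its two colours. -/
theorem isSiteInterfaceLoop_map_shift (w : Site 2) {ω : SiteConfig (Site 2)} {f : HexVertex}
    {γ : hexGraph.Walk f f} (h : IsSiteInterfaceLoop ω γ) :
    IsSiteInterfaceLoop (SiteConfig.relabel (Site.shift w) ω) (γ.map (hexAddHom w)) := by
  refine ⟨h.1.map (hexAddHom_injective w), fun d hd ↦ ?_⟩
  rw [SimpleGraph.Walk.darts_map, List.mem_map] at hd
  obtain ⟨d, hd, rfl⟩ := hd
  obtain ⟨e, he, h₁, h₂⟩ := h.2 d hd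
  refine ⟨⟨(e.fst + w, e.snd + w), (triGraph_adj_shift_iff w e.fst e.snd).2 e.adj⟩, ?_,
    (add_mem_relabel_shift_iff w ω _).2 h₁, fun h' ↦ h₂ ((add_mem_relabel_shift_iff w ω _).1 h')⟩
  rw [triEdgeFaces_shift, he]
  rfl

/-! ## §3 Geometry: drawn polygons and types under translation -/

/-- **The drawn polygon of the translated walk is the translated polygon** (mesh `δ`: face centres
move rigidly by `δ·triEmbed w`, polylines commute with affine maps). -/
theorem hexLoopCurve_map_shift (δ : ℝ) (w : Site 2) {f g : HexVertex} (γ : hexGraph.Walk f g) :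
    hexLoopCurve δ (γ.map (hexAddHom w)) = (hexLoopCurve δ γ).map T[triMeshPoint δ w] := by
  apply Curve.ext
  ext u
  change ((γ.map (hexAddHom w)).toCurve fun v ↦ (δ : ℂ) * hexCenter v) u =
    1 * (γ.toCurve fun v ↦ (δ : ℂ) * hexCenter v) u + triMeshPoint δ w
  simp only [SimpleGraph.Walk.toCurve, SimpleGraph.Walk.support_map, List.map_map]
  obtain ⟨l, hl⟩ : ∃ l, γ.support = f :: l := ⟨γ.support.tail, (γ.cons_tail_support).symm⟩
  have hcomp : ((fun v ↦ (δ : ℂ) * hexCenter v) ∘ ⇑(hexAddHom w)) =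
      (fun z : ℂ ↦ 1 * z + triMeshPoint δ w) ∘ (fun v ↦ (δ : ℂ) * hexCenter v) := by
    funext v
    obtain ⟨c, j⟩ := v
    simp only [Function.comp_apply, hexAddHom_apply, hexCenter_add, triMeshPoint]
    ring
  rw [hcomp, ← List.map_map, hl, List.map_cons]
  exact (apply_polylineFrom (fun z : ℂ ↦ 1 * z + triMeshPoint δ w) (fun x y s ↦ by
    simp only [AffineMap.lineMap_apply_module, Complex.real_smul]; push_cast; ring) _ _ u).symm

/-- The same for the curve classes `siteLoopCurve`. -/
theorem siteLoopCurve_map_shift (δ : ℝ) (w : Site 2) {f : HexVertex} (γ : hexGraph.Walk f f) :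
    siteLoopCurve δ (γ.map (hexAddHom w)) = (siteLoopCurve δ γ).map T[triMeshPoint δ w] := by
  change CurveClass.mk (hexLoopCurve δ (γ.map (hexAddHom w))) =
    (CurveClass.mk (hexLoopCurve δ γ)).map T[triMeshPoint δ w]
  rw [CurveClass.map_mk, hexLoopCurve_map_shift]

/-- The same for unbased loops. -/
theorem unbasedLoop_siteLoopCurve_map_shift (δ : ℝ) (w : Site 2) {f : HexVertex}
    (γ : hexGraph.Walk f f) :
    UnbasedLoop.mk (BasedLoop.mk (siteLoopCurve δ (γ.map (hexAddHom w)))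
        (isLoop_siteLoopCurve δ (γ.map (hexAddHom w)))) =
      (UnbasedLoop.mk (BasedLoop.mk (siteLoopCurve δ γ) (isLoop_siteLoopCurve δ γ))).map
        T[triMeshPoint δ w] (isometry_translate (triMeshPoint δ w)) := by
  rw [UnbasedLoop.map_mk, BasedLoop.map_mk]
  exact congrArg UnbasedLoop.mk (BasedLoop.mk_eq_mk.2 (siteLoopCurve_map_shift δ w γ))

/-- Translation does not change the shoelace sum of the visited face centres (hence not the type). -/
theorem shoelace_support_map_shift (w : Site 2) {f g : HexVertex} (γ : hexGraph.Walk f g) :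
    shoelace ((γ.map (hexAddHom w)).support.map hexCenter) = shoelace (γ.support.map hexCenter) := by
  have h : (γ.map (hexAddHom w)).support.map hexCenter =
      (γ.support.map hexCenter).map (triEmbed w + ·) := by
    rw [SimpleGraph.Walk.support_map, List.map_map, List.map_map]
    refine List.map_congr_left fun v _ ↦ ?_
    obtain ⟨c, j⟩ := v
    simp only [Function.comp_apply, hexAddHom_apply, hexCenter_add]
  rw [h, shoelace_map_const_add]

/-- Translating a walk by `−w` and then by `w` does not change its support. -/
theorem support_map_neg_map (w : Site 2) {f g : HexVertex} (γ : hexGraph.Walk f g) :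
    ((γ.map (hexAddHom (-w))).map (hexAddHom w)).support = γ.support := by
  rw [SimpleGraph.Walk.support_map, SimpleGraph.Walk.support_map, List.map_map]
  conv_rhs => rw [← List.map_id γ.support]
  refine List.map_congr_left fun v _ ↦ ?_
  obtain ⟨c, j⟩ := v
  simp [hexAddHom_apply]

/-- The curve class of a closed walk only depends on its support. -/
theorem siteLoopCurve_eq_of_support_eq (δ : ℝ) {f f' : HexVertex} {γ : hexGraph.Walk f f}
    {γ' : hexGraph.Walk f' f'} (h : γ.support = γ'.support) : siteLoopCurve δ γ = siteLoopCurve δ γ' := by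
  unfold siteLoopCurve SimpleGraph.Walk.toCurve
  rw [h]

end SiteTranslation

open SiteTranslation in
/-- **Lattice translations act on the typed loop representation of site-`𝕋` by translating the
loops** (registered helper toward Ξ₂ `uvFarBiteSq_expMoment_latticeEnsembles`, line
`positive-cone-weight-doubling`; the site twin of `bondLoopConfig_relabel_shift`).  For every mesh
`δ`, lattice vector `w ∈ 𝕋 ≅ ℤ²` and configuration `ω`, the typed loop configuration of the
translated configuration `ω + w = SiteConfig.relabel (Site.shift w) ω` is the push-forward of the
typed loop configuration of `ω` along the translation `z ↦ z + triMeshPoint δ w` of the plane: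
interface loops translate (`isSiteInterfaceLoop_map_shift`), drawn polygons translate
(`siteLoopCurve_map_shift`), types are kept (`shoelace_support_map_shift`). -/
theorem siteLoopConfig_relabel_shift : ∀ (δ : ℝ) (w : Site 2) (ω : SiteConfig (Site 2)),
    siteLoopConfig δ (SiteConfig.relabel (Site.shift w) ω) =
      (siteLoopConfig δ ω).map ⟨fun z : ℂ ↦ 1 * z + triMeshPoint δ w, continuous_translate (triMeshPoint δ w)⟩
        (isometry_translate (triMeshPoint δ w)) := by
  intro δ w ω; ext i u; simp only [mem_siteLoopConfig_iff, LoopConfig.mem_map_iff]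
  constructor
  · rintro ⟨v', γ', h', ht, rfl⟩
    have hγ : IsSiteInterfaceLoop ω (γ'.map (hexAddHom (-w))) := by
      have := isSiteInterfaceLoop_map_shift (-w) h'
      rwa [siteRelabel_shift_neg_shift] at this
    have hsupp : ((γ'.map (hexAddHom (-w))).map (hexAddHom w)).support = γ'.support :=
      support_map_neg_map w γ'
    refine ⟨_, ⟨_, γ'.map (hexAddHom (-w)), hγ, ?_, rfl⟩, ?_⟩
    · rw [ht, ← shoelace_support_map_shift w (γ'.map (hexAddHom (-w))), hsupp]
    · rw [← unbasedLoop_siteLoopCurve_map_shift]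
      exact congrArg UnbasedLoop.mk (BasedLoop.mk_eq_mk.2 (siteLoopCurve_eq_of_support_eq δ hsupp))
  · rintro ⟨_, ⟨v, γ, h, ht, rfl⟩, rfl⟩
    exact ⟨_, γ.map (hexAddHom w), isSiteInterfaceLoop_map_shift w h,
      by rw [shoelace_support_map_shift]; exact ht, (unbasedLoop_siteLoopCurve_map_shift δ w γ).symm⟩

namespace SiteTranslation

/-- The translation `z ↦ z + b` of the plane (local notation, re-declared after the anchor). -/
local notation3 "T[" b "]" => (⟨fun z : ℂ ↦ 1 * z + (b : ℂ), continuous_translate b⟩ : C(ℂ, ℂ))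

/-! ## §4 The loop sets of `tEns` under translation; translations preserve `P_{1/2}` -/

/-- **The loops of `tEns` at mesh `δ` of the translated configuration are the loops translated by
`triMeshPoint δ w`.** -/
theorem loops_tEns_relabel_shift (δ : ℝ) (w : Site 2) (ω : SiteConfig (Site 2)) :
    (tEns.X δ (SiteConfig.relabel (Site.shift w) ω)).loops =
      UnbasedLoop.map T[triMeshPoint δ w] (isometry_translate (triMeshPoint δ w)) '' (tEns.X δ ω).loops := by
  change (siteLoopConfig δ _).loops = UnbasedLoop.map _ _ '' (siteLoopConfig δ ω).loops
  rw [siteLoopConfig_relabel_shift, BondTranslation.loops_map]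

/-- **`ω ↦ ω + w` preserves `tEns.P = P_{1/2}`** (`sitePercolation_map_relabel`). -/
theorem measurePreserving_relabel_shift_tEns (w : Site 2) :
    MeasurePreserving (SiteConfig.relabel (Site.shift w)) tEns.P tEns.P := by
  change MeasurePreserving _ (sitePercolation (Site 2) half) (sitePercolation (Site 2) half)
  exact ⟨(SiteConfig.relabel _).measurable, sitePercolation_map_relabel (Site.shift w) half⟩

/-- Change of variables: `∫ F(ω + w) dP = ∫ F dP` for EVERY real `F` (no measurability needed). -/
theorem integral_comp_relabel_shift_tEns (w : Site 2) (F : SiteConfig (Site 2) → ℝ) :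
    ∫ ω, F (SiteConfig.relabel (Site.shift w) ω) ∂tEns.P = ∫ ω, F ω ∂tEns.P :=
  (measurePreserving_relabel_shift_tEns w).integral_comp' F

/-- **The law of the loop set of `tEns` is invariant under lattice translations**: for every mesh
`δ`, `w ∈ ℤ² ≅ 𝕋` and EVERY real statistic `G` of a set of loops,
`∫ G((· + triMeshPoint δ w) '' loops(X_δ ω)) dP = ∫ G(loops(X_δ ω)) dP`. -/
theorem integral_comp_translate_loops_tEns (δ : ℝ) (w : Site 2) (G : Set (UnbasedLoop ℂ) → ℝ) :
    ∫ ω, G (UnbasedLoop.map T[triMeshPoint δ w] (isometry_translate (triMeshPoint δ w)) ''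
        (tEns.X δ ω).loops) ∂tEns.P = ∫ ω, G (tEns.X δ ω).loops ∂tEns.P := by
  rw [← integral_comp_relabel_shift_tEns w fun ω ↦ G (tEns.X δ ω).loops]
  simp only [loops_tEns_relabel_shift]

/-! ## §5 Both lattices: every point is `2δ`-close to a law-preserving translation vector -/

/-- Every point of the plane is within `2δ` of a point of `δℤ²` (`δ > 0`). -/
theorem exists_dist_meshPoint_le {δ : ℝ} (hδ : 0 < δ) (x : ℂ) :
    ∃ w : Site 2, dist x (meshPoint δ w) ≤ 2 * δ := by
  have key : ∀ a : ℝ, |a - δ * (⌊a / δ⌋ : ℤ)| ≤ δ := by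
    intro a
    have h1 := Int.floor_le (a / δ)
    have h2 := Int.lt_floor_add_one (a / δ)
    have ha : δ * (a / δ) = a := by field_simp
    rw [abs_le]
    constructor <;> nlinarith
  refine ⟨![⌊x.re / δ⌋, ⌊x.im / δ⌋], ?_⟩
  rw [Complex.dist_eq]
  refine (Complex.norm_le_abs_re_add_abs_im _).trans ?_
  have h0 := key x.re
  have h1 := key x.im
  simp only [Complex.sub_re, Complex.sub_im, meshPoint_re, meshPoint_im, Matrix.cons_val_zero,
    Matrix.cons_val_one] at h0 h1 ⊢
  linarith

/-- **Both lattice ensembles: law-preserving translations are `2δ`-dense.**  For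
`E ∈ latticeEnsembles`, `δ > 0` and every `x ∈ ℂ` there is a vector `b` with `dist x b ≤ 2δ` such
that translating the loop set of `X_δ` by `b` does not change its law:
`∫ G((· + b) '' loops) dP = ∫ G(loops) dP` for every real statistic `G`
(`BondTranslation.integral_comp_translate_loops_zEns`, `integral_comp_translate_loops_tEns`,
nearest lattice points `exists_dist_meshPoint_le`, `exists_dist_triMeshPoint_le`). -/
theorem exists_near_translate_loops_latticeEnsembles : ∀ E ∈ latticeEnsembles, ∀ {δ : ℝ}, 0 < δ →
    ∀ x : ℂ, ∃ b : ℂ, dist x b ≤ 2 * δ ∧ ∀ G : Set (UnbasedLoop ℂ) → ℝ,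
      ∫ ω, G (UnbasedLoop.map T[b] (isometry_translate b) '' (E.X δ ω).loops) ∂E.P =
        ∫ ω, G (E.X δ ω).loops ∂E.P := by
  intro E hE δ hδ x
  simp only [latticeEnsembles, Set.mem_insert_iff, Set.mem_singleton_iff] at hE
  rcases hE with rfl | rfl
  · obtain ⟨w, hw⟩ := exists_dist_meshPoint_le hδ x
    exact ⟨meshPoint δ w, hw, fun G ↦ BondTranslation.integral_comp_translate_loops_zEns δ w G⟩
  · obtain ⟨w, hw⟩ := exists_dist_triMeshPoint_le hδ x
    exact ⟨triMeshPoint δ w, hw.trans (by linarith), fun G ↦ integral_comp_translate_loops_tEns δ w G⟩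

end SiteTranslation

end Summit.CriticalPhenomena.CardyFormulaZ2.Cruxes.NestingRigidity.PositiveConeWeightDoubling

end
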